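import Summits.ABC.ABC.Theorems.TwistAmplificationMazurKaneLawSqrtLatticeToolX

-- Summit.ABC.ABC is the mandated summit-side namespace (single-conjunct summit); the lakefile sets the same option tree-wide.
set_option linter.dupNamespace false

/-!
# The square-root lattice tool for the shape count `B_d`, host the `z`-term (crux stmt-ABC-2757, stub `sqrtLatticeToolZ`)

Stub S7 of the line `fibre-toolkit-lp-wall-map` for the crux
`Summit.ABC.ABC.Theses.TwistAmplification.MazurKaneLaw`; the twin of
`Summit.ABC.ABC.Theorems.MazurKaneLaw.sqrtLatticeToolX` (stub S6) with the host moved to the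
`z`-term.  The shape count `B_d = AbcShapes.shapeCount c₁ c₂ c₃ X Y Z` counts the `(x, y, z)` in
the dyadic boxes `[X, 2X) × [Y, 2Y) × [Z, 2Z)` with `c₁ ∏ xⱼ^{j+1} + c₂ ∏ yⱼ^{j+1} = c₃ ∏ zⱼ^{j+1}`
and `gcd(c₁ ∏ xⱼ, c₂ ∏ yⱼ, c₃ ∏ zⱼ) = 1`.  The tool
(`Summit.ABC.ABC.Theorems.MazurKaneLaw.sqrtLatticeToolZ`) bounds `B_d` for a set `H` of host
coordinates (in the `z`-term) and a coordinate `i ≥ 1` (level `k = i + 1 ≥ 2` in the two other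
terms):

* freeze the `z`-coordinates off `H` and the `x`-, `y`-coordinates other than `i` (fibres indexed by
  `subBox {i} X × subBox {i} Y × subBox H Z`); on the fibre over `(r₁, r₂, r₃)` the equation reads
  `A·x^k + B·y^k = M·m` with `A = c₁ offVal_{i}(r₁)`, `B = c₂ offVal_{i}(r₂)`,
  `M = c₃ offVal_H(r₃) ≥ c₃ offVal_H(Z)`, `m = W_H(z)`, `x = xᵢ < 2Xᵢ`, `y = yᵢ < 2Yᵢ`, and the
  three terms are pairwise coprime (`AbcShapes.coprime_terms_of_mem`), so `x, y, A` are units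
  modulo `M` and `gcd(x, y) = 1`;
* in `ZMod M` the equation reads `(M - B % M)·y^k = A·x^k` (`M - B % M ≡ -B`), so by
  `card_pairs_rootClass_le` (root classes `x·y⁻¹` in one coset of the `k`-th roots of unity, each
  class a congruence lattice whose primitive points in the box are few) the pairs `(yᵢ, xᵢ)` number
  at most `#μ_k(ZMod M) · (2 + 28·(2Yᵢ)(2Xᵢ)/M)`, and `#μ_k(ZMod M) ≤ Dτ^{i+2}`
  (`natCard_rootsOfUnity_le_pow`);
* `(x, y)` determines `m = W_H(z)`, and the host tuples `z_H` with that value number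
  `≤ τ(m)^d ≤ Dτ^d` (`AbcShapes.card_subBox_filter_dvd_le`);
* summing over the `#subBox_{i} X · #subBox_{i} Y · #subBox_H Z` fibres gives the stated bound
  `B_d ≤ #fibres · Dτ^{d+(i+2)} · (2 + 112 XᵢYᵢ/(c₃ offVal_H Z))`.

No new definitions.
-/

namespace Summit.ABC.ABC.Theorems.MazurKaneLaw

open Finset
open Literature.NumberTheory.DiophantineGeometry
open Literature.NumberTheory.DiophantineGeometry.AbcShapes

/-- A natural-number lift of `-B` modulo `M ≥ 1`: `M - B % M ≡ -B (mod M)`. [folklore] -/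
theorem natCast_sub_mod_eq_neg {M : ℕ} (hM : 0 < M) (B : ℕ) :
    ((M - B % M : ℕ) : ZMod M) = -(B : ZMod M) := by
  rw [Nat.cast_sub (Nat.mod_lt B hM).le, ZMod.natCast_self, ZMod.natCast_mod, zero_sub]

/-- **The square-root lattice tool, host the `z`-term** (stub S7 `sqrtLatticeToolZ` of the line
`fibre-toolkit-lp-wall-map`): for positive `cᵢ`, boxes with positive parameters,
`T ≥ cᵢ · ∏ⱼ (2·)^{j+1}`, `τ(m) ≤ Dτ` for `1 ≤ m ≤ T`, a set `H` of host coordinates (in the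
`z`-term) and a coordinate `i ≥ 1`,
`B_d ≤ #subBox_{i} X · #subBox_{i} Y · #subBox_H Z · Dτ^{d+(i+2)} · (2 + 112 XᵢYᵢ / (c₃ offVal_H Z))`.
Proof: fibre over the frozen coordinates; on a non-empty fibre the equation is
`A·x^{i+1} + B·y^{i+1} = M·m` with pairwise coprime terms, `M = c₃ offVal_H ≥ c₃ offVal_H Z`,
`M ≤ T`; the pairs `(yᵢ, xᵢ)` number at most `#μ_{i+1}(ZMod M) · (2 + 112 XᵢYᵢ/M)`
(`card_pairs_rootClass_le` with coefficients `M - B % M ≡ -B` and `A`, `gcd(A, M) = 1`) with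
`#μ_{i+1}(ZMod M) ≤ Dτ^{i+2}` (`natCard_rootsOfUnity_le_pow`), and over each pair the host tuples
number at most `Dτ^d` (`AbcShapes.card_subBox_filter_dvd_le`, the value `m = W_H(z)` being
determined). [folklore] -/
theorem sqrtLatticeToolZ : ∀ {d : ℕ} {c₁ c₂ c₃ : ℕ}, 0 < c₁ → 0 < c₂ → 0 < c₃ → ∀ (X Y Z : Fin d → ℕ), (∀ j, 0 < X j) → (∀ j, 0 < Y j) → (∀ j, 0 < Z j) → ∀ {T Dτ : ℕ}, c₁ * Literature.NumberTheory.DiophantineGeometry.AbcShapes.shapeVal (fun j => 2 * X j) ≤ T → c₂ * Literature.NumberTheory.DiophantineGeometry.AbcShapes.shapeVal (fun j => 2 * Y j) ≤ T → c₃ * Literature.NumberTheory.DiophantineGeometry.AbcShapes.shapeVal (fun j => 2 * Z j) ≤ T → (∀ m : ℕ, m ≠ 0 → m ≤ T → m.divisors.card ≤ Dτ) → ∀ (H : Finset (Fin d)) (i : Fin d), 1 ≤ (i : ℕ) → (Literature.NumberTheory.DiophantineGeometry.AbcShapes.shapeCount c₁ c₂ c₃ X Y Z : ℝ) ≤ ((Literature.NumberTheory.DiophantineGeometry.AbcShapes.subBox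 ({i} : Finset (Fin d)) X).card * (Literature.NumberTheory.DiophantineGeometry.AbcShapes.subBox ({i} : Finset (Fin d)) Y).card * (Literature.NumberTheory.DiophantineGeometry.AbcShapes.subBox H Z).card : ℕ) * (Dτ : ℝ) ^ (d + ((i : ℕ) + 2)) * (2 + 112 * ((X i : ℝ) * Y i) / ((c₃ * Literature.NumberTheory.DiophantineGeometry.AbcShapes.offVal H Z : ℕ) : ℝ)) := by
  classical
  intro d c₁ c₂ c₃ hc₁ hc₂ hc₃ X Y Z hX hY hZ T Dτ hTX hTY hTZ hD H i hi
  set S : Finset (Fin d) := {i} with hS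
  set F := shapeTriples c₁ c₂ c₃ X Y Z
  set O := subBox S X ×ˢ subBox S Y ×ˢ subBox H Z with hO
  set φ : (Fin d → ℕ) × (Fin d → ℕ) × (Fin d → ℕ) → (Fin d → ℕ) × (Fin d → ℕ) × (Fin d → ℕ) :=
    fun t => (freezeOn S X t.1, freezeOn S Y t.2.1, freezeOn H Z t.2.2) with hφ
  have hmaps : Set.MapsTo φ (F : Set _) (O : Set _) := by
    intro t ht
    obtain ⟨hbox, -⟩ := mem_filter.mp (mem_coe.mp ht)
    simp only [mem_product] at hbox
    exact mem_coe.mpr (mem_product.mpr ⟨freezeOn_mem_subBox S hbox.1,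
      mem_product.mpr ⟨freezeOn_mem_subBox S hbox.2.1, freezeOn_mem_subBox H hbox.2.2⟩⟩)
  -- general facts on the frozen values and cofactors
  have honS : ∀ u : Fin d → ℕ, onVal S u = u i ^ ((i : ℕ) + 1) := fun u => by simp [hS, onVal]
  have hoffle : ∀ (S' : Finset (Fin d)) {W r : Fin d → ℕ}, (∀ j, 0 < r j) → (∀ j, r j ≤ 2 * W j) →
      offVal S' r ≤ shapeVal (fun j => 2 * W j) := by
    intro S' W r hr hle
    calc offVal S' r ≤ offVal S' r * onVal S' r :=
          Nat.le_mul_of_pos_right _ (prod_pos fun j _ => pow_pos (hr j) _)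
      _ = shapeVal r := (shapeVal_eq_offVal_mul_onVal S' r).symm
      _ ≤ shapeVal (fun j => 2 * W j) := shapeVal_mono hle
  have hoffmono : ∀ (S' : Finset (Fin d)) {u v : Fin d → ℕ}, (∀ j, u j ≤ v j) →
      offVal S' u ≤ offVal S' v := fun S' _ _ h =>
    prod_le_prod (fun _ _ => Nat.zero_le _) fun j _ => Nat.pow_le_pow_left (h j) _
  have hval : ∀ {w : Fin d → ℕ}, w ∈ dyadicBox Z →
      onVal H w ≠ 0 ∧ (onVal H w).divisors.card ≤ Dτ := by
    intro w hw
    have hwpos : ∀ j, 0 < w j := fun j => lt_of_lt_of_le (hZ j) ((mem_dyadicBox.mp hw) j).1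
    have h0 : 0 < onVal H w := prod_pos fun j _ => pow_pos (hwpos j) _
    have hle : onVal H w ≤ T :=
      calc onVal H w ≤ offVal H w * onVal H w :=
            Nat.le_mul_of_pos_left _ (prod_pos fun j _ => pow_pos (hwpos j) _)
        _ = shapeVal w := (shapeVal_eq_offVal_mul_onVal H w).symm
        _ ≤ shapeVal (fun j => 2 * Z j) := shapeVal_mono fun j => ((mem_dyadicBox.mp hw) j).2.le
        _ ≤ c₃ * shapeVal (fun j => 2 * Z j) := Nat.le_mul_of_pos_left _ hc₃
        _ ≤ T := hTZ
    exact ⟨h0.ne', hD _ h0.ne' hle⟩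
  have hfac : ∀ {v : ℕ}, v ≠ 0 → v.divisors.card ≤ Dτ →
      ((subBox Hᶜ Z).filter (fun s => onVal H s = v)).card ≤ Dτ ^ d := by
    intro v hv0 hvD
    refine (card_subBox_filter_dvd_le Hᶜ Z hv0 _ fun s _ hs j hj => ?_).trans
      (Nat.pow_le_pow_left hvD d)
    rw [← hs]; exact dvd_onVal H s (by rwa [mem_compl, not_not] at hj)
  have key : ∀ (W u u' : Fin d → ℕ), freezeOn S W u = freezeOn S W u' → u i = u' i → u = u' := by
    intro W u u' hf hui
    funext j
    by_cases hj : j = i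
    · rw [hj]; exact hui
    · have hjS : j ∉ S := by simp [hS, hj]
      have := congrFun hf j
      simpa [freezeOn, hjS] using this
  have hdvd : ∀ M u : ℕ, u ∣ M * u ^ ((i : ℕ) + 1) := fun M u =>
    Dvd.dvd.mul_left (dvd_pow_self u (Nat.succ_ne_zero _)) M
  set Bnd : ℝ := (Dτ : ℝ) ^ (d + ((i : ℕ) + 2)) *
    (2 + 112 * ((X i : ℝ) * Y i) / ((c₃ * offVal H Z : ℕ) : ℝ)) with hBnd
  have hBnd0 : 0 ≤ Bnd := by positivity
  /- the bound on one fibre -/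
  have hfib : ∀ o ∈ O, ((F.filter (fun t => φ t = o)).card : ℝ) ≤ Bnd := by
    rintro ⟨ox, oy, oz⟩ ho
    set Fo := F.filter (fun t => φ t = (ox, oy, oz))
    simp only [hO, mem_product] at ho
    obtain ⟨-, -, hoz⟩ := ho
    have hbz := mem_dyadicBox.mp (subBox_subset hZ hoz)
    have hozpos : ∀ j, 0 < oz j := fun j => lt_of_lt_of_le (hZ j) (hbz j).1
    -- the coefficients of the fibre equation `A·x^{i+1} + B·y^{i+1} = M·m`
    set A : ℕ := c₁ * offVal S ox with hA
    set B : ℕ := c₂ * offVal S oy with hB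
    set M : ℕ := c₃ * offVal H oz with hM
    have hMpos : 0 < M := Nat.mul_pos hc₃ (prod_pos fun j _ => pow_pos (hozpos j) _)
    have hMT : M ≤ T := (Nat.mul_le_mul_left c₃ (hoffle H hozpos fun j => (hbz j).2.le)).trans hTZ
    have hM₀ : c₃ * offVal H Z ≤ M := Nat.mul_le_mul_left c₃ (hoffmono H fun j => (hbz j).1)
    -- what membership in the fibre means
    have hmem : ∀ t ∈ Fo, (t.1 ∈ dyadicBox X ∧ t.2.1 ∈ dyadicBox Y ∧ t.2.2 ∈ dyadicBox Z) ∧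
        (freezeOn S X t.1 = ox ∧ freezeOn S Y t.2.1 = oy ∧ freezeOn H Z t.2.2 = oz) ∧
        A * t.1 i ^ ((i : ℕ) + 1) + B * t.2.1 i ^ ((i : ℕ) + 1) = M * onVal H t.2.2 ∧
        Nat.Coprime (A * t.1 i ^ ((i : ℕ) + 1)) (B * t.2.1 i ^ ((i : ℕ) + 1)) ∧
        Nat.Coprime (A * t.1 i ^ ((i : ℕ) + 1)) (M * onVal H t.2.2) ∧
        Nat.Coprime (B * t.2.1 i ^ ((i : ℕ) + 1)) (M * onVal H t.2.2) := by
      intro t ht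
      obtain ⟨htF, hφt⟩ := mem_filter.mp ht
      have hcop := coprime_terms_of_mem htF
      obtain ⟨hbox, heq, -⟩ := mem_filter.mp htF
      simp only [hφ, Prod.mk.injEq] at hφt
      obtain ⟨h1, h2, h3⟩ := hφt
      have e1 : c₁ * shapeVal t.1 = A * t.1 i ^ ((i : ℕ) + 1) := by
        rw [shapeVal_eq_offVal_mul_onVal S t.1, ← offVal_freezeOn S X t.1, h1, honS, hA,
          mul_assoc]
      have e2 : c₂ * shapeVal t.2.1 = B * t.2.1 i ^ ((i : ℕ) + 1) := by
        rw [shapeVal_eq_offVal_mul_onVal S t.2.1, ← offVal_freezeOn S Y t.2.1, h2, honS, hB,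
          mul_assoc]
      have e3 : c₃ * shapeVal t.2.2 = M * onVal H t.2.2 := by
        rw [shapeVal_eq_offVal_mul_onVal H t.2.2, ← offVal_freezeOn H Z t.2.2, h3, hM, mul_assoc]
      rw [e1, e2, e3] at heq
      rw [e1, e2] at hcop
      refine ⟨by simpa only [mem_product] using hbox, ⟨h1, h2, h3⟩, heq, hcop, ?_, ?_⟩
      · rw [← heq]; exact Nat.coprime_self_add_right.mpr hcop
      · rw [← heq]; exact Nat.coprime_add_self_right.mpr hcop.symm
    rcases Fo.eq_empty_or_nonempty with he | ⟨t₀, ht₀⟩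
    · rw [he, card_empty, Nat.cast_zero]; exact hBnd0
    obtain ⟨-, -, -, -, h13₀, -⟩ := hmem t₀ ht₀
    have hAM : A.Coprime M :=
      (h13₀.coprime_dvd_left (dvd_mul_right A _)).coprime_dvd_right (dvd_mul_right M _)
    -- project the fibre to the pairs `(yᵢ, xᵢ)`
    set π : (Fin d → ℕ) × (Fin d → ℕ) × (Fin d → ℕ) → ℕ × ℕ := fun t => (t.2.1 i, t.1 i) with hπ
    -- (a) over each pair the fibre has at most `Dτ^d` points
    have hFoP : Fo.card ≤ Dτ ^ d * (Fo.image π).card := by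
      refine card_le_mul_card_image Fo (Dτ ^ d) fun w hw => ?_
      obtain ⟨t₁, ht₁, rfl⟩ := mem_image.mp hw
      obtain ⟨⟨-, -, hbz₁⟩, -, heq₁, -⟩ := hmem t₁ ht₁
      obtain ⟨hv0, hvD⟩ := hval hbz₁
      refine le_trans ?_ (hfac hv0 hvD)
      refine card_le_card_of_injOn (fun t => freezeOn Hᶜ Z t.2.2) (fun t ht => ?_)
        (fun t ht t' ht' h => ?_)
      · obtain ⟨htF, hπt⟩ := mem_filter.mp (mem_coe.mp ht)
        obtain ⟨⟨-, -, hbz'⟩, -, heq, -⟩ := hmem t htF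
        simp only [hπ, Prod.mk.injEq] at hπt
        have hv : onVal H t.2.2 = onVal H t₁.2.2 := by
          refine Nat.eq_of_mul_eq_mul_left hMpos (heq.symm.trans ?_)
          rw [hπt.1, hπt.2]; exact heq₁
        refine mem_coe.mpr (mem_filter.mpr ⟨freezeOn_mem_subBox Hᶜ hbz', ?_⟩)
        rw [onVal_freezeOn_compl, hv]
      · obtain ⟨htF, hπt⟩ := mem_filter.mp (mem_coe.mp ht)
        obtain ⟨ht'F, hπt'⟩ := mem_filter.mp (mem_coe.mp ht')
        obtain ⟨-, ⟨f1, f2, f3⟩, -, -⟩ := hmem t htF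
        obtain ⟨-, ⟨f1', f2', f3'⟩, -, -⟩ := hmem t' ht'F
        have hyx := hπt.trans hπt'.symm
        simp only [hπ, Prod.mk.injEq] at hyx
        dsimp only at h
        refine Prod.ext ?_ (Prod.ext ?_ ?_)
        · exact key X _ _ (f1.trans f1'.symm) hyx.2
        · exact key Y _ _ (f2.trans f2'.symm) hyx.1
        · rw [← mergeOn_freezeOn H Z t.2.2, ← mergeOn_freezeOn H Z t'.2.2, f3, f3', h]
    -- (b) the pairs: root classes times primitive lattice points
    have hPle : ((Fo.image π).card : ℝ) ≤ Nat.card {ρ : ZMod M // ρ ^ ((i : ℕ) + 1) = 1} *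
        (2 + 28 * ((2 * Y i : ℕ) : ℝ) * ((2 * X i : ℕ) : ℝ) / M) := by
      refine card_pairs_rootClass_le hMpos hAM (M - B % M) ((i : ℕ) + 1) (2 * Y i) (2 * X i)
        (Fo.image π) fun w hw => ?_
      obtain ⟨t, ht, rfl⟩ := mem_image.mp hw
      obtain ⟨⟨hbx', hby', -⟩, -, heq, h12, h13, h23⟩ := hmem t ht
      simp only [hπ]
      refine ⟨⟨((mem_dyadicBox.mp hby') i).2.le, ((mem_dyadicBox.mp hbx') i).2.le⟩, ?_, ?_, ?_, ?_⟩
      · exact (h12.symm.coprime_dvd_left (hdvd B _)).coprime_dvd_right (hdvd A _)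
      · exact (h23.coprime_dvd_left (hdvd B _)).coprime_dvd_right (dvd_mul_right M _)
      · exact (h13.coprime_dvd_left (hdvd A _)).coprime_dvd_right (dvd_mul_right M _)
      · have h := congrArg (Nat.cast : ℕ → ZMod M) heq
        push_cast at h
        rw [ZMod.natCast_self, zero_mul] at h
        rw [natCast_sub_mod_eq_neg hMpos, neg_mul, neg_eq_iff_add_eq_zero, add_comm, h]
    have hroots : Nat.card {ρ : ZMod M // ρ ^ ((i : ℕ) + 1) = 1} ≤ Dτ ^ ((i : ℕ) + 2) :=
      natCard_rootsOfUnity_le_pow hMpos.ne' (hD M hMpos.ne' hMT)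
    -- (c) assemble
    have h0 : (0 : ℝ) < ((c₃ * offVal H Z : ℕ) : ℝ) := by
      exact_mod_cast Nat.mul_pos hc₃ (prod_pos fun j _ => pow_pos (hZ j) _)
    have h1 : ((c₃ * offVal H Z : ℕ) : ℝ) ≤ (M : ℝ) := by exact_mod_cast hM₀
    have h2 : 112 * ((X i : ℝ) * Y i) / M ≤ 112 * ((X i : ℝ) * Y i) / ((c₃ * offVal H Z : ℕ) : ℝ) :=
      div_le_div_of_nonneg_left (by positivity) h0 h1
    calc (Fo.card : ℝ) ≤ ((Dτ ^ d * (Fo.image π).card : ℕ) : ℝ) := by exact_mod_cast hFoP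
      _ = (Dτ : ℝ) ^ d * (Fo.image π).card := by push_cast; ring
      _ ≤ (Dτ : ℝ) ^ d * (Nat.card {ρ : ZMod M // ρ ^ ((i : ℕ) + 1) = 1} *
            (2 + 28 * ((2 * Y i : ℕ) : ℝ) * ((2 * X i : ℕ) : ℝ) / M)) :=
          mul_le_mul_of_nonneg_left hPle (by positivity)
      _ ≤ (Dτ : ℝ) ^ d * (((Dτ ^ ((i : ℕ) + 2) : ℕ) : ℝ) *
            (2 + 28 * ((2 * Y i : ℕ) : ℝ) * ((2 * X i : ℕ) : ℝ) / M)) :=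
          mul_le_mul_of_nonneg_left (mul_le_mul_of_nonneg_right (by exact_mod_cast hroots)
            (by positivity)) (by positivity)
      _ = (Dτ : ℝ) ^ (d + ((i : ℕ) + 2)) * (2 + 112 * ((X i : ℝ) * Y i) / M) := by
          push_cast; ring
      _ ≤ Bnd := by
          rw [hBnd]
          exact mul_le_mul_of_nonneg_left (by linarith) (by positivity)
  /- summing over the fibres -/
  calc (shapeCount c₁ c₂ c₃ X Y Z : ℝ) = (F.card : ℝ) := rfl
    _ = ∑ o ∈ O, ((F.filter (fun t => φ t = o)).card : ℝ) := by
        rw [card_eq_sum_card_fiberwise hmaps]; push_cast; rfl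
    _ ≤ ∑ o ∈ O, Bnd := sum_le_sum hfib
    _ = O.card * Bnd := by rw [sum_const, nsmul_eq_mul]
    _ = _ := by rw [hO, card_product, card_product, hBnd]; push_cast; ring

end Summit.ABC.ABC.Theorems.MazurKaneLaw
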